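import Summits.QuantumFields.YangMills.Theorems.BalabanUVNodesN09ChartReadAveragingSubmersion
import Literature.MathematicalPhysics.QuantumFieldTheory.Balaban1983to89.Node00.RegSetOfLocalFaces
import Literature.MathematicalPhysics.QuantumFieldTheory.Balaban1983to89.B12ContinuousTransportInvarianceOn
import HarnessLib

/-!
# BalabanUVNodes ∕ N09 — THE LOCAL ROUTE CLOSED BY NAME FOR CONTINUOUS DENSITIES ON THE α-GUARD: every open set of coarse fields lies in the maximal regular set of the kernel
# transform, `HasContTransportOn` holds there, and the canonical transport `TcanOfRecord ρ` is continuous — for every bounded density `ρ` continuous on a closed subset of the loop α-guard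

Cell `pub-ymgap`, width seat `pub-ymgap-dag-n09-w4` generation 5 (HUMAN RULING D-0149; DAG node N09 = [Balaban1987RG1] §§2–5; INBOX CLAIM-1∕INTENT-1 l.32428, FILE 3 of the
(M3r)-local lane).  `--kind proof --supports stmt-QuantumFields-27364 --as helper` (K1⁹ `StabilityBRunRowsAtRecordR13SepCoPHV`, rev 29; lineage of the K1⁸ 26907 helpers; count-neutral; theorems only, 0 def ∕ 0 instance ∕ 0 notation ∕ 0 sorry).

WHY.  dag-n09-w2 g4's record door `Node00.RegSetOfLocalFaces.regular_of_engineFaces` (p619855) displays ONE hypothesis `hengine`: at every `U₀` of the closed support `K₀`, continuity of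
`(avOfRecord F N K k).avg` and the ENGINE-form flat local face of its chart reading at `0` (p610570's conclusion shape).  Files 1–2 of this lane
(`…N09ChartReadAveragingSmooth` p620237, `…N09ChartReadAveragingSubmersion`) PROVE both for every `U₀` of the loop α-guard (`continuousAt_avgFun_of_small`, `engineFace_chartRead_avgFun`).
THIS FILE is the junction: `hengine` discharged ⇒ ★★★ `regular_of_loopSmall` — for `k < K`, `ρ ≥ 0` measurable bounded, zero off a closed `K₀`, continuous at the points of `K₀`,
`K₀` inside the α-guard (`dist1 (loopHol U c i) ≤ α`, `α ≤ 1∕24`, `α < δ_N`, `157·α < L^{1−d}`): every open `U` of coarse fields satisfies `U ⊆ regSetOfRecord F N K k ρ` and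
`HasContTransportOn F N K k ρ U`, and `TcanOfRecord F N K k ρ` is continuous on ALL coarse fields; corollaries `subset_regSetOfRecord_of_loopSmall`, `hasContTransportOn_of_loopSmall`,
`continuous_TcanOfRecord_of_loopSmall`, and ★ `domAlt_subset_regSetOfRecord_of_loopSmall` — the SHAPE of the N09 doors' binder `hreg` (`domAltOfRecord … (k+1) ⊆ regSetOfRecord … k ρ`,
`B12ContinuousTransportInvarianceOn.isOpen_domAltOfRecord`) for every such CONTINUOUS `ρ`.

HONEST FRAMING.  LOCATED, count-neutral bookkeeping BY NAME (one `exact` over dag-n09-w2's door with files 1–2); the density class is CONTINUOUS-on-the-guard: the record's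
`betaInputOfRecord` carries the SHARP cut-off `χ_k` and is NOT in this class — `hreg` AT THE RECORD'S DENSITY is NOT discharged here (it needs the sharp engine p613264 + the (2.9)
thresholds' transversality, located, not in this lane's files); NO chart of Bałaban's constructed, NO estimate; N09 NOT discharged; conjunct 1 (Lemma 4) ∕ FLAG №7 untouched; K0⁷ ∕
K1⁸ ∕ K3⁷ NOT closed; counts unmoved (typed 28∕28 · discharged 5∕28); no summit statement is proved here; R4 = the conditional finite-𝕋⁴ rung `BalabanLadder.UV` only — NOT continuum ∕
ℝ⁴ ∕ OS; the Yang–Mills mass gap (Clay) is NOT proved by any of this.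
-/

noncomputable section

open scoped Matrix.Norms.L2Operator Topology ENNReal
open Filter Set Function MeasureTheory

namespace Summit.QuantumFields.YangMills.BalabanUVNodes.N09ContTransportOfLoopSmall

open Literature.MathematicalPhysics.QuantumFieldTheory.Balaban1983to89
open Literature.MathematicalPhysics.QuantumFieldTheory.Balaban1983to89.HaarExponentialChart
open Literature.MathematicalPhysics.QuantumFieldTheory.Balaban1983to89.BlockAveraging (Small Idx avgFun loopHol)
open Literature.MathematicalPhysics.QuantumFieldTheory.Balaban1983to89.ExpMeanLog (expMeanLogSU deltaSU)
open Literature.MathematicalPhysics.QuantumFieldTheory.Balaban1983to89.Node00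
open Summit.QuantumFields.YangMills.BalabanUVNodes.N09ChartReadAveragingSmooth
open Summit.QuantumFields.YangMills.BalabanUVNodes.N09ChartReadAveragingSubmersion

section Engine

variable {F : T4Continuum.T4Family} {N : ℕ} [NeZero N] {K k : ℕ}
variable [MeasurableSpace (specialUnitaryLogChart (Fin N)).lie] [BorelSpace (specialUnitaryLogChart (Fin N)).lie]
  (η : Measure (specialUnitaryLogChart (Fin N)).lie) [η.IsAddHaarMeasure]

/-- ★★ **`hengine` OF dag-n09-w2's `regular_of_engineFaces`, DISCHARGED ON THE α-GUARD**: at every `U₀` of a set `K₀` inside the loop α-guard, the averaging of record is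
continuous AND its chart reading carries the ENGINE-form flat local face at `0` (files 1–2: `continuousAt_avgFun_of_small`, `engineFace_chartRead_avgFun`).
[cite: Balaban1987RG1, (0.4) p.253, (2.1)–(2.10) pp.265–267; EvansGariepy1992, §3.4.3 Thm 2] -/
theorem engineFaces_avOfRecord_of_loopSmall (hk : k < K) {α : ℝ} (hα24 : α ≤ 1 / 24) (hαδ : α < deltaSU (Fin N))
    (hαL : 157 * α < (((F.P K).L : ℝ) ^ ((F.P K).d - 1))⁻¹) {K₀ : Set (GaugeField (F.P K) k (SU N))}
    (hK₀α : ∀ U ∈ K₀, ∀ c i, dist1 (loopHol U c i) ≤ α) :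
    ∀ U₀ ∈ K₀, ContinuousAt (avOfRecord F N K k).avg U₀ ∧
      ∃ O : Set (PBond (F.P K) k → (specialUnitaryLogChart (Fin N)).lie), IsOpen O ∧
        (0 : PBond (F.P K) k → (specialUnitaryLogChart (Fin N)).lie) ∈ O ∧
        ∃ D : Set (PBond (F.P K) (k + 1) → (specialUnitaryLogChart (Fin N)).lie), IsOpen D ∧
        (fun A : PBond (F.P K) k → (specialUnitaryLogChart (Fin N)).lie =>
            (fun (V : PBond (F.P K) (k + 1) → SU N) (c : PBond (F.P K) (k + 1)) =>
              (isChartRep_specialUnitaryGroup (n := Fin N)).logChart (V c * ((avOfRecord F N K k).avg U₀ c)⁻¹))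
              ((avOfRecord F N K k).avg
                (fun b => (isChartRep_specialUnitaryGroup (n := Fin N)).expChart (A b) * U₀ b))) 0 ∈ D ∧
        ∀ r : (PBond (F.P K) k → (specialUnitaryLogChart (Fin N)).lie) → ℝ, Measurable r → (∀ A, 0 ≤ r A) →
          ContinuousOn r O → (∃ C₀ : ℝ, ∀ A ∈ O, r A ≤ C₀) → (∀ A, A ∉ O → r A = 0) →
          ∃ I : (PBond (F.P K) (k + 1) → (specialUnitaryLogChart (Fin N)).lie) → ℝ, ContinuousOn I D ∧ (∀ w, 0 ≤ I w) ∧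
            ∀ A' : Set (PBond (F.P K) (k + 1) → (specialUnitaryLogChart (Fin N)).lie), MeasurableSet A' → A' ⊆ D →
              ((Measure.pi fun _ : PBond (F.P K) k => η).withDensity fun A => ENNReal.ofReal (r A))
                  ((fun A : PBond (F.P K) k → (specialUnitaryLogChart (Fin N)).lie =>
                      (fun (V : PBond (F.P K) (k + 1) → SU N) (c : PBond (F.P K) (k + 1)) =>
                        (isChartRep_specialUnitaryGroup (n := Fin N)).logChart (V c * ((avOfRecord F N K k).avg U₀ c)⁻¹))
                        ((avOfRecord F N K k).avg
                          (fun b => (isChartRep_specialUnitaryGroup (n := Fin N)).expChart (A b) * U₀ b))) ⁻¹' A') =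
                ∫⁻ w in A', ENNReal.ofReal (I w) ∂(Measure.pi fun _ : PBond (F.P K) (k + 1) => η) := by
  intro U₀ hU₀
  have hsmall : ∀ c, Small (expMeanLogSU (n := Fin N)) U₀ c := fun c i => lt_of_le_of_lt (hK₀α U₀ hU₀ c i) hαδ
  have hj : k + 1 ≤ (F.P K).m + (F.P K).K := by simp only [T4Continuum.T4Family.P_K]; omega
  exact ⟨continuousAt_avgFun_of_small (P := F.P K) (j := k) U₀ hsmall,
    engineFace_chartRead_avgFun (P := F.P K) (j := k) U₀ η hj (hK₀α U₀ hU₀) hα24 hαδ hαL⟩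

end Engine

section Regular

variable {F : T4Continuum.T4Family} {N : ℕ} [NeZero N] {K k : ℕ}

/-- ★★★ **THE LOCAL ROUTE CLOSED FOR CONTINUOUS DENSITIES ON THE α-GUARD.**  For `k < K`, `ρ ≥ 0` measurable and bounded, zero off a closed `K₀` inside the loop α-guard and
continuous at the points of `K₀`: every open set `U` of coarse fields lies in `regSetOfRecord F N K k ρ` with `HasContTransportOn F N K k ρ U`, and the canonical transport
`TcanOfRecord F N K k ρ` is continuous on ALL coarse fields (dag-n09-w2's `regular_of_engineFaces` with `hengine` := the previous theorem).
[cite: Balaban1987RG1, (0.13) p.254 and p.259, (2.10) p.267] -/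
theorem regular_of_loopSmall (hk : k < K) {α : ℝ} (hα24 : α ≤ 1 / 24) (hαδ : α < deltaSU (Fin N))
    (hαL : 157 * α < (((F.P K).L : ℝ) ^ ((F.P K).d - 1))⁻¹) {ρ : Density (F.P K) k (SU N)}
    (hρm : Measurable ρ) (hρ0 : ∀ U, 0 ≤ ρ U) (hρC : ∃ C₀ : ℝ, ∀ U, ρ U ≤ C₀)
    {K₀ : Set (GaugeField (F.P K) k (SU N))} (hK₀ : IsClosed K₀) (hρK : ∀ U, U ∉ K₀ → ρ U = 0) (hρc : ∀ U ∈ K₀, ContinuousAt ρ U)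
    (hK₀α : ∀ U ∈ K₀, ∀ c i, dist1 (loopHol U c i) ≤ α) :
    (∀ U : Set (PBond (F.P K) (k + 1) → SU N), IsOpen U → U ⊆ regSetOfRecord F N K k ρ ∧ HasContTransportOn F N K k ρ U) ∧
      Continuous (TcanOfRecord F N K k ρ) := by
  letI : MeasurableSpace (specialUnitaryLogChart (Fin N)).lie := borel _
  haveI : BorelSpace (specialUnitaryLogChart (Fin N)).lie := ⟨rfl⟩
  exact RegSetOfLocalFaces.regular_of_engineFaces (Module.finBasis ℝ (specialUnitaryLogChart (Fin N)).lie).addHaar hk hρm hρ0 hρC hK₀ hρK hρc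
    (engineFaces_avOfRecord_of_loopSmall _ hk hα24 hαδ hαL hK₀α)

/-- Corollary: every open set of coarse fields is inside the maximal regular set of the transform of such a `ρ`. [cite: Balaban1987RG1, p.259 («effective actions for small fields»)] -/
theorem subset_regSetOfRecord_of_loopSmall (hk : k < K) {α : ℝ} (hα24 : α ≤ 1 / 24) (hαδ : α < deltaSU (Fin N))
    (hαL : 157 * α < (((F.P K).L : ℝ) ^ ((F.P K).d - 1))⁻¹) {ρ : Density (F.P K) k (SU N)}
    (hρm : Measurable ρ) (hρ0 : ∀ U, 0 ≤ ρ U) (hρC : ∃ C₀ : ℝ, ∀ U, ρ U ≤ C₀)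
    {K₀ : Set (GaugeField (F.P K) k (SU N))} (hK₀ : IsClosed K₀) (hρK : ∀ U, U ∉ K₀ → ρ U = 0) (hρc : ∀ U ∈ K₀, ContinuousAt ρ U)
    (hK₀α : ∀ U ∈ K₀, ∀ c i, dist1 (loopHol U c i) ≤ α) {U : Set (PBond (F.P K) (k + 1) → SU N)} (hU : IsOpen U) :
    U ⊆ regSetOfRecord F N K k ρ :=
  ((regular_of_loopSmall hk hα24 hαδ hαL hρm hρ0 hρC hK₀ hρK hρc hK₀α).1 U hU).1

/-- Corollary: `HasContTransportOn` on every open set of coarse fields for such a `ρ`. [cite: Balaban1987RG1, (0.13) p.254, p.259] -/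
theorem hasContTransportOn_of_loopSmall (hk : k < K) {α : ℝ} (hα24 : α ≤ 1 / 24) (hαδ : α < deltaSU (Fin N))
    (hαL : 157 * α < (((F.P K).L : ℝ) ^ ((F.P K).d - 1))⁻¹) {ρ : Density (F.P K) k (SU N)}
    (hρm : Measurable ρ) (hρ0 : ∀ U, 0 ≤ ρ U) (hρC : ∃ C₀ : ℝ, ∀ U, ρ U ≤ C₀)
    {K₀ : Set (GaugeField (F.P K) k (SU N))} (hK₀ : IsClosed K₀) (hρK : ∀ U, U ∉ K₀ → ρ U = 0) (hρc : ∀ U ∈ K₀, ContinuousAt ρ U)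
    (hK₀α : ∀ U ∈ K₀, ∀ c i, dist1 (loopHol U c i) ≤ α) {U : Set (PBond (F.P K) (k + 1) → SU N)} (hU : IsOpen U) :
    HasContTransportOn F N K k ρ U :=
  ((regular_of_loopSmall hk hα24 hαδ hαL hρm hρ0 hρC hK₀ hρK hρc hK₀α).1 U hU).2

/-- Corollary: the canonical transport of such a `ρ` is continuous on all coarse fields. [cite: Balaban1987RG1, (0.13) p.254, p.259] -/
theorem continuous_TcanOfRecord_of_loopSmall (hk : k < K) {α : ℝ} (hα24 : α ≤ 1 / 24) (hαδ : α < deltaSU (Fin N))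
    (hαL : 157 * α < (((F.P K).L : ℝ) ^ ((F.P K).d - 1))⁻¹) {ρ : Density (F.P K) k (SU N)}
    (hρm : Measurable ρ) (hρ0 : ∀ U, 0 ≤ ρ U) (hρC : ∃ C₀ : ℝ, ∀ U, ρ U ≤ C₀)
    {K₀ : Set (GaugeField (F.P K) k (SU N))} (hK₀ : IsClosed K₀) (hρK : ∀ U, U ∉ K₀ → ρ U = 0) (hρc : ∀ U ∈ K₀, ContinuousAt ρ U)
    (hK₀α : ∀ U ∈ K₀, ∀ c i, dist1 (loopHol U c i) ≤ α) :
    Continuous (TcanOfRecord F N K k ρ) :=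
  (regular_of_loopSmall hk hα24 hαδ hαL hρm hρ0 hρC hK₀ hρK hρc hK₀α).2

/-- ★ **THE `hreg` SHAPE FOR CONTINUOUS GUARDED DENSITIES**: `domAltOfRecord F N ν K (k+1) ⊆ regSetOfRecord F N K k ρ` — the binder of the N09 small-field-bookkeeping doors, for every
bounded `ρ ≥ 0` continuous on a closed subset of the α-guard and zero off it (the (2.9) second-form domain is open, `isOpen_domAltOfRecord`).  NOT the record's `betaInputOfRecord`
(sharp cut-off): see the module docstring. [cite: Balaban1987RG1, p.259, (2.9) p.266] -/
theorem domAlt_subset_regSetOfRecord_of_loopSmall (ν : Stage7Numerics) (hk : k < K) {α : ℝ} (hα24 : α ≤ 1 / 24) (hαδ : α < deltaSU (Fin N))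
    (hαL : 157 * α < (((F.P K).L : ℝ) ^ ((F.P K).d - 1))⁻¹) {ρ : Density (F.P K) k (SU N)}
    (hρm : Measurable ρ) (hρ0 : ∀ U, 0 ≤ ρ U) (hρC : ∃ C₀ : ℝ, ∀ U, ρ U ≤ C₀)
    {K₀ : Set (GaugeField (F.P K) k (SU N))} (hK₀ : IsClosed K₀) (hρK : ∀ U, U ∉ K₀ → ρ U = 0) (hρc : ∀ U ∈ K₀, ContinuousAt ρ U)
    (hK₀α : ∀ U ∈ K₀, ∀ c i, dist1 (loopHol U c i) ≤ α) :
    domAltOfRecord F N ν K (k + 1) ⊆ regSetOfRecord F N K k ρ :=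
  subset_regSetOfRecord_of_loopSmall hk hα24 hαδ hαL hρm hρ0 hρC hK₀ hρK hρc hK₀α
    (B12ContinuousTransportInvarianceOn.isOpen_domAltOfRecord (F := F) (N := N) ν K (k + 1))

end Regular

end Summit.QuantumFields.YangMills.BalabanUVNodes.N09ContTransportOfLoopSmall
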